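import Literature.NumberTheory.GaloisRepresentations.ContinuousCohomologyTwistEulerCharacteristic
import Literature.NumberTheory.GaloisRepresentations.ContinuousH1FiniteOfBoundedIndex
import Literature.RepresentationTheory.FiniteGroups.MatrixTwistFixedVectors
import Mathlib.LinearAlgebra.Dimension.Free
import HarnessLib

/-!
# The prime-to-`p` base case of Tate's global Euler characteristic from the equivariant identity
# in `ψ`-form — model-free version (Milne ADT I, proof of Thm. 5.1)

Topic `NumberTheory/GaloisRepresentations`; namespace `Literature.NumberTheory.GaloisRepresentations`
(dot notation under `ContinuousRep`).  Theorems only; no definition, no named fact, no `sorry`, no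
instance, no notation.

`G` a compact group (in the application `G = ↥U`, `U` open in `G_{K,S}`), `W ⊴ G` open normal of index
prime to `p`, `Δ = G ⧸ W`; `ρ : G → Aut(A)` continuous with `A ≅ ℤ/p` (`e : ZMod p ≃+ A`; ANY model of
`μ_p` — e.g. `MuCarrier K p`, or the `p`-torsion `E_S[p]` of the `S`-units used by the Kummer
computation) and `τ : G → Aut(M)` continuous on a finite `𝔽_p`-module, BOTH trivial on `W`;
`𝓗ⁿ := Hⁿ(G, Maps(Δ, A))` (`ρ.coindOpen W hW`) with its right `Δ`-action `R = ρ.coindOpenHRep W hW n`.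

* **`euler_characteristic_of_psi_identity`**: if `𝓗¹, 𝓗²` are finite and, for every `ℤ`-valued
  invariant `ψ` of `ℤ[Δ]`-modules additive on short exact sequences of finite `p`-torsion modules
  (the `(ψ, hψ)` binders of `RepresentationTheory/FiniteGroups/StableLatticeReductionInvariantInt`),
  `ψ(𝓗⁰) + ψ(𝓗²) + r • ψ(𝔽_p[Δ]) = ψ(𝓗¹)` (hypothesis `hB6b`), then
  `v_p #H⁰(G, M) − v_p #H¹(G, M) + v_p #H²(G, M) + r · v_p #M = 0`
  (and `euler_characteristic_of_psi_identity_of_zsmul` with `pM = 0` instead of `[Module (ZMod p) M]`).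

Proof: `ContinuousCohomologyTwistEulerCharacteristic.euler_characteristic_of_fixedCount` at the matrices
`coordMatrix` of `M ⊗ μ_p^{⊗-1}` (`MatrixTwistFixedVectors`), `hB6b` read at
`ψ := v_p #{Δ-fixed vectors of X ⊗ M′}` (`additive_padicValNat_fixedVectors`, `natCard_fixedVectors_permQuot`).
This is the form consumed by the adapter from the lane's Kummer computation (brick B8-arith, stated for
`E_S[p]`) to the hypothesis `hbase` of `TateGlobalEulerCharacteristicTCOfBase` (lane «TATE-EPC-TC»,
cell `bsd-eis`, stmt-BirchSwinnertonDyer-19032, brick B8-alg (E-ψ)).  HONEST FRAMING: conditional on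
`hB6b`; no arithmetic and no case of BSD is proved here.

## References
* J. S. Milne, *Arithmetic Duality Theorems*, 2nd ed. (2006), I Thm. 5.1 (proof, p. 69), Lemma 5.4. [MilneADT2006]
* J. Neukirch, A. Schmidt, K. Wingberg, *Cohomology of Number Fields*, 2nd ed. (2008), (8.7.4). [NeukirchSchmidtWingberg2008]
-/

noncomputable section

open CategoryTheory Function
open scoped Topology Pointwise

namespace Literature.NumberTheory.GaloisRepresentations

open Literature.RepresentationTheory.FiniteGroups
open _root_.TopRep _root_.ContRepresentation _root_.ContinuousCohomology

namespace ContinuousRep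

section

variable {G : Type} [Group G] [TopologicalSpace G] [IsTopologicalGroup G] [CompactSpace G]
variable {A : Type} [AddCommGroup A] [TopologicalSpace A] [DiscreteTopology A]
variable {M : Type} [AddCommGroup M] [TopologicalSpace M] [DiscreteTopology M] [Finite M] {p : ℕ} [Fact p.Prime]
variable (ρ : ContinuousRep G ℤ A) (τ : ContinuousRep G ℤ M) (W : Subgroup G) [W.Normal]
  (hW : IsOpen (W : Set G)) (e : ZMod p ≃+ A)
  (hWA : ∀ w ∈ W, ∀ v : A, ρ w v = v) (hWM : ∀ w ∈ W, ∀ m : M, τ w m = m)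
  (hcop : ¬ p ∣ Nat.card (G ⧸ W)) (r : ℕ)
  (hfin₁ : Finite (continuousCohomology 1 (ρ.coindOpen W hW).toTopRep))
  (hfin₂ : Finite (continuousCohomology 2 (ρ.coindOpen W hW).toTopRep))
  (hB6b : ∀ (ψ : ∀ ⦃X : Type⦄ [AddCommGroup X] [Module ℤ X], Representation ℤ (G ⧸ W) X → ℤ),
    (∀ ⦃X Y Z : Type⦄ [AddCommGroup X] [Module ℤ X] [AddCommGroup Y] [Module ℤ Y]
      [AddCommGroup Z] [Module ℤ Z] (ρX : Representation ℤ (G ⧸ W) X)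
      (ρY : Representation ℤ (G ⧸ W) Y) (ρZ : Representation ℤ (G ⧸ W) Z)
      (f : X →ₗ[ℤ] Y) (g : Y →ₗ[ℤ] Z),
      (∀ s x, f (ρX s x) = ρY s (f x)) → (∀ s y, g (ρY s y) = ρZ s (g y)) →
      Injective f → Surjective g → LinearMap.range f = LinearMap.ker g → Finite Y →
      (∀ y : Y, (p : ℤ) • y = 0) → ψ ρY = ψ ρX + ψ ρZ) →
    ψ (ρ.coindOpenHRep W hW 0) + ψ (ρ.coindOpenHRep W hW 2) +
        r • ψ ((Representation.ofMulAction ℤ (G ⧸ W) (G ⧸ W)).quotient ((p : ℤ) • ⊤)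
          (StableLatticeReduction.smul_top_le_comap _ (p : ℤ))) =
      ψ (ρ.coindOpenHRep W hW 1))

include e hWA hWM hcop hfin₁ hfin₂ hB6b in
/-- **`v_p #H⁰(G, M) − v_p #H¹(G, M) + v_p #H²(G, M) + r · v_p #M = 0` from the `ψ`-form identity
`hB6b`** (`M` an `𝔽_p`-module, any model `A ≅ ℤ/p` of `μ_p`).
[cite: MilneADT2006, I Thm. 5.1 (proof)] [cite: NeukirchSchmidtWingberg2008, (8.7.4)] -/
theorem euler_characteristic_of_psi_identity [Module (ZMod p) M] :
    ((padicValNat p (Nat.card (continuousCohomology 0 τ.toTopRep)) : ℤ) -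
        padicValNat p (Nat.card (continuousCohomology 1 τ.toTopRep)) +
        padicValNat p (Nat.card (continuousCohomology 2 τ.toTopRep)) +
      (r : ℕ) * padicValNat p (Nat.card M)) = 0 := by
  classical
  haveI : Finite A := Finite.of_equiv _ e.toEquiv
  haveI : Finite (G ⧸ W) := Subgroup.quotient_finite_of_isOpen W hW
  letI : Fintype (G ⧸ W) := Fintype.ofFinite _
  have hcop' : ¬ p ∣ Fintype.card (G ⧸ W) := by rwa [Fintype.card_eq_nat_card]
  -- a basis of the `𝔽_p`-vector space `M` and the matrices of `M ⊗ μ_p^{⊗-1}`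
  let bv : Module.Basis (Fin (Module.finrank (ZMod p) M)) (ZMod p) M := Module.finBasis (ZMod p) M
  let σ' := ρ.untwistRep τ W e hWA hWM
  let a := MatrixTwist.coordMatrix σ' bv
  have hpA : ∀ v : A, (p : ℤ) • v = 0 := fun v => zsmul_natCast_eq_zero_of_addEquiv e v
  have ha1 : ∀ x : Fin (Module.finrank (ZMod p) M) → A, matAct (a 1) x = x :=
    fun x => MatrixTwist.sum_coordMatrix_one σ' bv x
  have hamul : ∀ (c c' : G ⧸ W) (x : Fin (Module.finrank (ZMod p) M) → A),
      matAct (a (c * c')) x = matAct (a c) (matAct (a c') x) :=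
    fun c c' x => MatrixTwist.sum_coordMatrix_mul σ' bv hpA c c' x
  have hσ : ∀ c j, σ' c (bv j) = ∑ i, a c i j • bv i := fun c j => MatrixTwist.coordMatrix_spec σ' bv c j
  -- the equivariant identity read at `ψ := v_p #(fixed vectors)`
  have key := hB6b (fun X _ _ τX => (padicValNat p (Nat.card {h : Fin (Module.finrank (ZMod p) M) → X //
      ∀ c : G ⧸ W, (fun i => ∑ j, a c i j • τX c (h j)) = h}) : ℤ))
    (MatrixTwist.additive_padicValNat_fixedVectors a hcop'
      (fun X _ _ _ => MatrixTwist.sum_coordMatrix_one σ' bv)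
      (fun X _ _ hX => MatrixTwist.sum_coordMatrix_mul σ' bv hX))
  have hreg := MatrixTwist.natCard_fixedVectors_permQuot σ' bv
  have hMd : Nat.card M = p ^ Module.finrank (ZMod p) M := (natCard_eq_pow_of_basis e bv).1
  rw [hreg, hMd, padicValNat.prime_pow, nsmul_eq_mul] at key
  have hEuler : padicValNat p (Nat.card {h : Fin (Module.finrank (ZMod p) M) →
        continuousCohomology 0 (ρ.coindOpen W hW).toTopRep //
        ∀ c : G ⧸ W, (fun i => ∑ j, a c i j • ρ.coindOpenHRep W hW 0 c (h j)) = h}) +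
      padicValNat p (Nat.card {h : Fin (Module.finrank (ZMod p) M) →
        continuousCohomology 2 (ρ.coindOpen W hW).toTopRep //
        ∀ c : G ⧸ W, (fun i => ∑ j, a c i j • ρ.coindOpenHRep W hW 2 c (h j)) = h}) +
      r * Module.finrank (ZMod p) M =
      padicValNat p (Nat.card {h : Fin (Module.finrank (ZMod p) M) →
        continuousCohomology 1 (ρ.coindOpen W hW).toTopRep //
        ∀ c : G ⧸ W, (fun i => ∑ j, a c i j • ρ.coindOpenHRep W hW 1 c (h j)) = h}) := by
    exact_mod_cast key
  haveI := ContinuousRep.finite_coindOpen (M := A) W hW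
  exact ρ.euler_characteristic_of_fixedCount τ W hW e bv hWA hWM a ha1 hamul hσ hcop' r
    ((ρ.coindOpen W hW).finite_continuousCohomology_zero) hfin₁ hfin₂ hEuler

include e hWA hWM hcop hfin₁ hfin₂ hB6b in
/-- **The same with `pM = 0` as a hypothesis** (the `𝔽_p`-structure is `AddCommGroup.zmodModule`) —
the binder shape of the hypothesis `hbase` of `TateGlobalEulerCharacteristicTCOfBase`.
[cite: MilneADT2006, I Thm. 5.1 (proof)] [cite: NeukirchSchmidtWingberg2008, (8.7.4)] -/
theorem euler_characteristic_of_psi_identity_of_zsmul (hM : ∀ m : M, (p : ℤ) • m = 0) :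
    ((padicValNat p (Nat.card (continuousCohomology 0 τ.toTopRep)) : ℤ) -
        padicValNat p (Nat.card (continuousCohomology 1 τ.toTopRep)) +
        padicValNat p (Nat.card (continuousCohomology 2 τ.toTopRep)) +
      (r : ℕ) * padicValNat p (Nat.card M)) = 0 := by
  letI : Module (ZMod p) M := AddCommGroup.zmodModule fun m => by rw [← natCast_zsmul]; exact hM m
  exact ρ.euler_characteristic_of_psi_identity τ W hW e hWA hWM hcop r hfin₁ hfin₂ hB6b

end

end ContinuousRep

end Literature.NumberTheory.GaloisRepresentations

end
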